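import Summits.CriticalPhenomena.Ising3DConformalLimit.Theorems.FKParityRobustnessStrandShadowHteToggle
import Summits.CriticalPhenomena.Ising3DConformalLimit.Theorems.FKParityRobustnessStrandShadowHteDomainMono
import Summits.CriticalPhenomena.Ising3DConformalLimit.Theorems.FKParityRobustnessStrandShadowClusterLoopFibre
import Summits.CriticalPhenomena.Ising3DConformalLimit.Theorems.StrandShadow.Negative.PairSplitDeletion
import Literature.Probability.LatticeModels.ModifiedSimonInequality
import Literature.Probability.LatticeModels.LoopO1
import HarnessLib

/-!
# The footprint floor of the sourced loop-O(1) measure (line `loop-footprint-strand-mass`, crux `StrandShadow`,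
# stmt-CriticalPhenomena-14626)

Support file (lead prover-line-stmt-CriticalPhenomena-14626-c1-0).  For a finite graph `G`, `0 ≤ t < 1`,
sources `x ≠ y` and an edge `e` of `G`, with `Z^A = loopO1PartitionFunction G t A`, `E_e` the endpoint
pair of `e` and `K_x(F)` the `F`-component of `x`:

  `t·(Z^∅·Z^{{x,y} ∆ E_e} − Z^{xy}·Z^{E_e}) ≤ (1 − t²)·Z^∅·Σ_{F ∈ 𝒯_G(xy) : e ∈ E(K_x(F))} t^{|F|}`

(`footprintFloor`), i.e. `P^{xy}[e ∈ E(K_x)] ≥ ℓ^{xy}[e ∈ F] − ℓ^{∅}[e ∈ F] = (t/(1−t²))·⟨σ_xσ_y;σ_e⟩/⟨σ_xσ_y⟩`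
at `t = tanh β`: a LOWER bound on the density of the source cluster (strand + its blobs) of the
high-temperature expansion by a thermal energy-spin-spin correlation.  Proof: the one-edge law at `univ`
for the four source sets `∅, E_e, {x,y}, {x,y}∆E_e` (`stub_hteToggle`), the in/out splits
(`hteSum_eq_in_add_out`), the identity `(1 − t²)·In_Λ(e) = t·(g_Λ(E_e) − t·g_Λ(∅))`
(`in_empty_identity`), the key comparison "loop-edge density is monotone in the domain"
`In_Λ(e)·g_V(∅) ≤ g_Λ(∅)·In_V(e)` (`in_mul_le`, from `stub_hteDomainMono` = GKS II in HT dress), summed over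
the cluster fibres of `stub_clusterLoopFibre` (`Z⁰·W ≤ Z^{xy}·In⁰`), and real arithmetic (`footprint_arith`).
Verified by exact enumeration (Fractions) on five small graphs before formalisation.
-/

noncomputable section

open Finset SimpleGraph
open Literature.Probability.LatticeModels
open Summit.CriticalPhenomena.Ising3DConformalLimit.Theorems

namespace Summit.CriticalPhenomena.Ising3DConformalLimit.Theorems.StrandShadowFootprint

open scoped Classical symmDiff

section Footprint

variable {V : Type} [Fintype V] [DecidableEq V] (G : SimpleGraph V) [DecidableRel G.Adj]

/-- `g_Λ(A)` splits into the HT graphs containing a fixed edge `e` and those avoiding it. -/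
theorem hteSum_eq_in_add_out (Λ A : Finset V) (t : ℝ) (e : Sym2 V) :
    hteSum G Λ t A =
      (∑ R ∈ ((edgesIn G Λ).powerset.filter fun R : Finset (Sym2 V) => oddVerts Λ R = A).filter
          (fun R : Finset (Sym2 V) => e ∈ R), t ^ R.card) +
      ∑ R ∈ ((edgesIn G Λ).powerset.filter fun R : Finset (Sym2 V) => oddVerts Λ R = A).filter
          (fun R : Finset (Sym2 V) => e ∉ R), t ^ R.card := by
  unfold hteSum
  exact (Finset.sum_filter_add_sum_filter_not _ _ _).symm

/-- No HT graph of `Λ` contains an edge outside `ℰ_Λ`. -/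
theorem in_eq_zero_of_not_mem (Λ A : Finset V) (t : ℝ) {e : Sym2 V} (he : e ∉ edgesIn G Λ) :
    (∑ R ∈ ((edgesIn G Λ).powerset.filter fun R : Finset (Sym2 V) => oddVerts Λ R = A).filter
        (fun R : Finset (Sym2 V) => e ∈ R), t ^ R.card) = 0 := by
  refine Finset.sum_eq_zero fun R hR => ?_
  exfalso
  simp only [Finset.mem_filter, Finset.mem_powerset] at hR
  exact he (hR.1.1 hR.2)

/-- The one-edge law solved for the `e`-containing sourceless mass of a domain `Λ ∋ e`:
`(1 − t²)·In_Λ(e) = t·(g_Λ({u,v}) − t·g_Λ(∅))` (toggling at `A = ∅` and at `A = {u,v}`). -/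
theorem in_empty_identity (Λ : Finset V) (t : ℝ) {e : Sym2 V}
    (he : e ∈ edgesIn G Λ) :
    (1 - t ^ 2) * (∑ R ∈ ((edgesIn G Λ).powerset.filter fun R : Finset (Sym2 V) =>
        oddVerts Λ R = ∅).filter (fun R : Finset (Sym2 V) => e ∈ R), t ^ R.card)
      = t * (hteSum G Λ t (Finset.univ.filter fun w : V => w ∈ e) - t * hteSum G Λ t ∅) := by
  have h0 := stub_hteToggle V G Λ ∅ t e he
  have hE := stub_hteToggle V G Λ (Finset.univ.filter fun w : V => w ∈ e) t e he
  have e0 : (∅ : Finset V) ∆ (Finset.univ.filter fun w : V => w ∈ e)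
      = (Finset.univ.filter fun w : V => w ∈ e) := by
    ext v; simp [Finset.mem_symmDiff]
  have eE : (Finset.univ.filter fun w : V => w ∈ e) ∆ (Finset.univ.filter fun w : V => w ∈ e)
      = (∅ : Finset V) := by
    simp
  simp only [e0] at h0
  simp only [eE] at hE
  rw [hteSum_eq_in_add_out G Λ (Finset.univ.filter fun w : V => w ∈ e) t e,
    hteSum_eq_in_add_out G Λ ∅ t e, h0, hE]
  ring

/-- **Key comparison** (loop-edge density is monotone in the domain):
`In_Λ(e)·g_V(∅) ≤ g_Λ(∅)·In_V(e)`, i.e. `ℓ^∅_{G[Λ]}[e ∈ R] ≤ ℓ^∅_G[e ∈ R]`, from the one-edge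
law in `Λ` and in `V` and the HT-dressed Griffiths inequality. -/
theorem in_mul_le {t : ℝ}
    (ht0 : 0 ≤ t) (ht1 : t < 1) (Λ : Finset V) {e : Sym2 V} (heU : e ∈ edgesIn G Finset.univ) :
    (∑ R ∈ ((edgesIn G Λ).powerset.filter fun R : Finset (Sym2 V) => oddVerts Λ R = ∅).filter
        (fun R : Finset (Sym2 V) => e ∈ R), t ^ R.card) * hteSum G Finset.univ t ∅
      ≤ hteSum G Λ t ∅ *
        ∑ R ∈ ((edgesIn G Finset.univ).powerset.filter fun R : Finset (Sym2 V) =>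
            oddVerts Finset.univ R = ∅).filter (fun R : Finset (Sym2 V) => e ∈ R), t ^ R.card := by
  by_cases heΛ : e ∈ edgesIn G Λ
  · have h1t : 0 < 1 - t ^ 2 := by nlinarith
    have hΛ := in_empty_identity G Λ t heΛ
    have hU := in_empty_identity G Finset.univ t heU
    have hEΛ : (Finset.univ.filter fun w : V => w ∈ e) ⊆ Λ := by
      intro w hw
      rw [Finset.mem_filter] at hw
      exact (mem_edgesIn_iff.1 heΛ).2 w hw.2
    have hmono := stub_hteDomainMono V G t ht0 ht1 Λ _ hEΛ
    set InΛ := (∑ R ∈ ((edgesIn G Λ).powerset.filter fun R : Finset (Sym2 V) =>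
        oddVerts Λ R = ∅).filter (fun R : Finset (Sym2 V) => e ∈ R), t ^ R.card) with hInΛ
    set InU := (∑ R ∈ ((edgesIn G Finset.univ).powerset.filter fun R : Finset (Sym2 V) =>
        oddVerts Finset.univ R = ∅).filter (fun R : Finset (Sym2 V) => e ∈ R), t ^ R.card) with hInU
    set gΛ0 := hteSum G Λ t ∅ with hgΛ0
    set gΛE := hteSum G Λ t (Finset.univ.filter fun w : V => w ∈ e) with hgΛE
    set gU0 := hteSum G Finset.univ t ∅ with hgU0
    set gUE := hteSum G Finset.univ t (Finset.univ.filter fun w : V => w ∈ e) with hgUE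
    have h3 : (1 - t ^ 2) * (gΛ0 * InU - InΛ * gU0) = t * (gUE * gΛ0 - gΛE * gU0) := by
      linear_combination gΛ0 * hU - gU0 * hΛ
    have h4 : 0 ≤ t * (gUE * gΛ0 - gΛE * gU0) := mul_nonneg ht0 (by linarith)
    have h5 : 0 ≤ gΛ0 * InU - InΛ * gU0 :=
      (mul_nonneg_iff_of_pos_left h1t).1 (by rw [h3]; exact h4)
    linarith
  · rw [in_eq_zero_of_not_mem G Λ ∅ t heΛ, zero_mul]
    exact mul_nonneg (hteSum_nonneg G Λ ht0 ∅) (Finset.sum_nonneg fun R _ => pow_nonneg ht0 _)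

/-- Pure real arithmetic of the footprint floor: the in/out decompositions of the four loop
partition functions, the two toggling identities, the split `In^S = K_in + W` and the key
comparison `Z⁰·W ≤ Z^S·In⁰` give `t·(Z⁰Z^{S∆E} − Z^SZ^E) ≤ (1 − t²)·Z⁰·K_in`. -/
theorem footprint_arith {t Z0 ZE ZS ZSE O0 OE OS OSE In0 InS Kin W : ℝ} (ht : 0 ≤ t) (ht1 : t < 1)
    (hZ0 : Z0 = In0 + O0) (hZE : ZE = t * O0 + OE) (hZS : ZS = InS + OS)
    (hZSE : ZSE = t * OS + OSE) (hIn0 : In0 = t * OE) (hInS : InS = t * OSE)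
    (hsplit : InS = Kin + W) (hkey : Z0 * W ≤ ZS * In0) :
    t * (Z0 * ZSE - ZS * ZE) ≤ (1 - t ^ 2) * Z0 * Kin := by
  have hW : W = t * OSE - Kin := by linarith
  have hid : (1 - t ^ 2) * Z0 * Kin - t * (Z0 * ZSE - ZS * ZE)
      = (1 - t ^ 2) * (ZS * In0 - Z0 * W) := by
    rw [hW, hZ0, hZE, hZS, hZSE, hIn0, hInS]; ring
  have h1t : 0 ≤ 1 - t ^ 2 := by nlinarith
  have h2 : 0 ≤ (1 - t ^ 2) * (ZS * In0 - Z0 * W) := mul_nonneg h1t (sub_nonneg.2 hkey)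
  linarith

/-- **The footprint floor** (finite graph, dimension-free; the first LOWER bound on the density of the
source cluster of the sourced loop-O(1) measure, by a thermal `⟨σσ;ε⟩` correlation — proved from the
landed `stub_hteToggle` (p97523), `stub_hteDomainMono` (p97543), `stub_clusterLoopFibre` (p97987)).  For `0 ≤ t < 1`, sources `x ≠ y`, an edge `e` of `G`:
`t·(Z^∅·Z^{{x,y}∆E_e} − Z^{xy}·Z^{E_e}) ≤ (1 − t²)·Z^∅·Σ_{F ∈ 𝒯(xy) : e ∈ E(K_x(F))} t^|F|`,
i.e. `P^{xy}[e ∈ E(K_x)] ≥ ℓ^{xy}[e ∈ F] − ℓ^∅[e ∈ F]`.  Proof: one-edge law at `univ` (four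
source sets) + the key comparison summed over the cluster fibres + `footprint_arith`. -/
theorem footprintFloor :
    ∀ (V : Type) [Fintype V] [DecidableEq V] (G : SimpleGraph V) [DecidableRel G.Adj] (t : ℝ),
      0 ≤ t → t < 1 → ∀ (x y : V), x ≠ y → ∀ e ∈ G.edgeFinset,
      t * (loopO1PartitionFunction G t ∅ *
              loopO1PartitionFunction G t (({x, y} : Finset V) ∆ (Finset.univ.filter fun w : V => w ∈ e))
            - loopO1PartitionFunction G t {x, y} *
              loopO1PartitionFunction G t (Finset.univ.filter fun w : V => w ∈ e))
        ≤ (1 - t ^ 2) * loopO1PartitionFunction G t ∅ *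
            ∑ F ∈ (tJoins G Set.univ {x, y}).filter (fun F : Finset (Sym2 V) =>
                e ∈ F ∧ ∀ w ∈ e, (SimpleGraph.fromEdgeSet (↑F : Set (Sym2 V))).Reachable x w),
              t ^ F.card := by
  intro V _ _ G _ t ht0 ht1 x y _ e he
  obtain ⟨hW, hZS⟩ := stub_clusterLoopFibre V G t x y e
  have heU : e ∈ edgesIn G Finset.univ := by rw [DepletionBound.edgesIn_univ]; exact he
  -- the four one-edge laws at `univ`
  have hT0 := stub_hteToggle V G Finset.univ ∅ t e heU
  have hTE := stub_hteToggle V G Finset.univ (Finset.univ.filter fun w : V => w ∈ e) t e heU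
  have hTS := stub_hteToggle V G Finset.univ ({x, y} : Finset V) t e heU
  have hTSE := stub_hteToggle V G Finset.univ
    (({x, y} : Finset V) ∆ (Finset.univ.filter fun w : V => w ∈ e)) t e heU
  have e0 : (∅ : Finset V) ∆ (Finset.univ.filter fun w : V => w ∈ e)
      = (Finset.univ.filter fun w : V => w ∈ e) := by
    ext v; simp [Finset.mem_symmDiff]
  have eE : (Finset.univ.filter fun w : V => w ∈ e) ∆ (Finset.univ.filter fun w : V => w ∈ e)
      = (∅ : Finset V) := by
    simp
  simp only [e0] at hT0
  simp only [eE] at hTE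
  simp only [symmDiff_symmDiff_cancel_right] at hTSE
  -- the four in/out splits at `univ`
  have hs0 := hteSum_eq_in_add_out G Finset.univ ∅ t e
  have hsE := hteSum_eq_in_add_out G Finset.univ (Finset.univ.filter fun w : V => w ∈ e) t e
  have hsS := hteSum_eq_in_add_out G Finset.univ ({x, y} : Finset V) t e
  have hsSE := hteSum_eq_in_add_out G Finset.univ
    (({x, y} : Finset V) ∆ (Finset.univ.filter fun w : V => w ∈ e)) t e
  rw [hTE] at hsE
  rw [hTSE] at hsSE
  -- `In^S = K_in + W`
  have hIdx := StrandShadowNegative.tJoins_univ_eq_filter G ({x, y} : Finset V)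
  have hsplit :
      (∑ R ∈ ((edgesIn G Finset.univ).powerset.filter fun R : Finset (Sym2 V) =>
          oddVerts Finset.univ R = ({x, y} : Finset V)).filter (fun R : Finset (Sym2 V) => e ∈ R),
          t ^ R.card)
        = (∑ F ∈ (tJoins G Set.univ {x, y}).filter (fun F : Finset (Sym2 V) =>
              e ∈ F ∧ ∀ w ∈ e, (SimpleGraph.fromEdgeSet (↑F : Set (Sym2 V))).Reachable x w),
            t ^ F.card) +
          ∑ F ∈ (tJoins G Set.univ {x, y}).filter (fun F : Finset (Sym2 V) =>
              e ∈ F ∧ ¬ ∀ w ∈ e, (SimpleGraph.fromEdgeSet (↑F : Set (Sym2 V))).Reachable x w),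
            t ^ F.card := by
    rw [hIdx, ← Finset.sum_filter_add_sum_filter_not
      ((((edgesIn G Finset.univ).powerset.filter fun R : Finset (Sym2 V) =>
          oddVerts Finset.univ R = ({x, y} : Finset V)).filter (fun R : Finset (Sym2 V) => e ∈ R)))
      (fun F : Finset (Sym2 V) => ∀ w ∈ e, (SimpleGraph.fromEdgeSet (↑F : Set (Sym2 V))).Reachable x w)]
    congr 1
    · refine Finset.sum_congr ?_ fun _ _ => rfl
      ext F
      simp only [Finset.mem_filter, and_assoc]
    · refine Finset.sum_congr ?_ fun _ _ => rfl
      ext F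
      simp only [Finset.mem_filter, and_assoc]
  -- the key comparison summed over the cluster fibres: `Z⁰·W ≤ Z^S·In⁰`
  have hkey : hteSum G Finset.univ t ∅ *
        (∑ F ∈ (tJoins G Set.univ {x, y}).filter (fun F : Finset (Sym2 V) =>
            e ∈ F ∧ ¬ ∀ w ∈ e, (SimpleGraph.fromEdgeSet (↑F : Set (Sym2 V))).Reachable x w),
          t ^ F.card)
      ≤ loopO1PartitionFunction G t {x, y} *
        ∑ R ∈ ((edgesIn G Finset.univ).powerset.filter fun R : Finset (Sym2 V) =>
            oddVerts Finset.univ R = ∅).filter (fun R : Finset (Sym2 V) => e ∈ R), t ^ R.card := by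
    rw [hW, hZS, Finset.mul_sum, Finset.sum_mul]
    refine Finset.sum_le_sum fun K _ => ?_
    have hk := in_mul_le G ht0 ht1
      (Finset.univ.filter fun v : V =>
        ¬ (SimpleGraph.fromEdgeSet (↑K : Set (Sym2 V))).Reachable x v) heU
    have htk : 0 ≤ t ^ K.card := pow_nonneg ht0 _
    nlinarith [mul_le_mul_of_nonneg_left hk htk]
  -- assemble
  rw [DepletionBound.loopO1PartitionFunction_eq_hteSum] at hkey
  simp only [DepletionBound.loopO1PartitionFunction_eq_hteSum]
  exact footprint_arith ht0 ht1 hs0 hsE hsS hsSE hT0 hTS hsplit hkey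

end Footprint

end Summit.CriticalPhenomena.Ising3DConformalLimit.Theorems.StrandShadowFootprint

end
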